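import Literature.Geometry.Lorentzian.FinalState
import Literature.Geometry.Lorentzian.Stationary
import HarnessLib

/-!
# Final state decompositions modelled on general stationary exteriors

Definition request `defn-StationaryFinalStateDecomposition` (route
`FinalStateConjecture/BeltLiouville`, item `FinalStateFromRigidity`): the hypothesis structure
`FinalStateDecomposition` of `KerrConvergence.lean` — the `N`-black-hole final state of the
folklore conjecture "generic asymptotically flat vacuum developments either disperse or settle
down to finitely many rotating Kerr black holes moving away from each other" (Dafermos–Luk,
arXiv:1710.01722, §1.2.1, p. 8; Penrose 1982, Problem 12) — with the boosted sub-extremal Kerr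
reference backgrounds `g_{Mᵢ,aᵢ} ∘ (Λᵢ, cᵢ)⁻¹` replaced by ARBITRARY stationary asymptotically flat
black holes `𝓑ᵢ : StationaryAFBlackHole` (`Stationary.lean`; Chruściel–Costa, arXiv:0806.0016,
§2.1–2.2), each read in a chosen **`T`-adapted late-time chart** `(t, y) ∈ Uᵢ ⊆ E4` of its domain
of outer communications (possibly extended by a collar across the future event horizon): time =
Killing parameter (`∂₀ ↦ T`, Alexakis–Ionescu–Klainerman, arXiv:0904.0982, §1.1, assumption
**GR**: "`T = ∂₀`, `r = √((x¹)² + (x²)² + (x³)²)`"), radius a time-independent function comparable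
to `‖y‖`. This is what a stationary-limit route needs in order to split "settles down to Kerr"
into "settles down to SOME stationary vacuum exteriors" + "those exteriors are Kerr" (rigidity /
no-hair: Chruściel–Costa Thm. 1.3, Alexakis–Ionescu–Klainerman).

## Contents (namespace `Literature.Geometry.Lorentzian`)

* `ModelBackground.boost B Λ c`: a reference background moved by the Poincaré motion `(Λ, c)`
  (generalises `boostedKerrBackground`: `Kerr.background_boost` is `rfl`).
* `FinalStateDecompositionOver 𝓢 𝒟 k B`: the background-generic part of `FinalStateDecomposition`
  for an arbitrary family `B : Fin N → ModelBackground` of hole backgrounds (common late time,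
  late-time charts, near-zone `Cᵏ` convergence on every truncated slab, separation, sublinear
  excision tubes, flat chart with full `Cᵏ` convergence to `η`, global covering clause —
  field-for-field the clauses of `FinalStateDecomposition`), with `region`, `radiationZone`,
  `charted`, `certifiedLate`, `certifiedSlab`, `HasExhaustiveCharts` (verbatim the shape of
  `Summit.FinalStateConjecture.HasExhaustiveCharts`, so that on the summit side
  `HasExhaustiveCharts d ↔ d.toOver.HasExhaustiveCharts` is `Iff.rfl`) and transport `copy`
  along an equality of background families.
* specialisation: `FinalStateDecomposition.toOver` / `FinalStateDecomposition.ofOver` (Kerr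
  backgrounds give back `FinalStateDecomposition`; both round trips are `rfl`).
* `StationaryAFBlackHole.AdaptedChart 𝓑` (the `T`-adapted chart data) with its reference
  background `AdaptedChart.background`, and the chart-level Kerr predicate `AdaptedChart.IsKerr`.
* `StationaryFinalStateDecomposition 𝓢 𝒟 k`: `N` holes `𝓑ᵢ`, adapted charts, motions
  `(Λᵢ, cᵢ)`, and a `FinalStateDecompositionOver` on the boosted adapted backgrounds; sanity
  `ofConvergesToMinkowski` (`N = 0`); and the **transfer**
  `StationaryFinalStateDecomposition.toFinalStateDecomposition`: if every adapted chart is the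
  ingoing Kerr–Schild exterior chart of a sub-extremal Kerr `(Mᵢ, aᵢ)` (`IsKerr`), the stationary
  decomposition is a `FinalStateDecomposition` with the same `N`, charts, charted region and
  exhaustive-charts property and with `Kerr.IsSubextremal` parameters.

## Design choices

* **One generic layer.** `FinalStateDecomposition` mentions Kerr only through the backgrounds
  `boostedKerrBackground Λᵢ cᵢ Mᵢ aᵢ` (its excision clause reads the hole radius
  `rᵢ(Λᵢ⁻¹(x − cᵢ))`, which is `(boostedKerrBackground …).radius x` definitionally), so the clauses
  are stated once over `B : Fin N → ModelBackground` and both structures are instances.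
* **Adapted charts carry the model metric as a total function.** `AdaptedChart.bilin : E4 → …` is
  data, constrained to equal the pullback `φ^* g_𝓑` ON the chart domain (values off the domain
  are junk, exactly as for `ModelBackground.bilin` and `boostedKerrBilin`). This makes the Kerr
  case LITERALLY `Kerr.background M a` (`IsKerr.background_eq`), so the transfer lemma is a
  transport along an equality of backgrounds, with every clause preserved by `rfl`.
* **What the adapted chart must satisfy** (anti-vacuity; cf. the reviews recorded in
  `KerrConvergence.lean`): smooth open embedding; time-translation invariant domain and
  `dφ(∂₀) = T` (so chart time is the Killing parameter); the chart covers the d.o.c.,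
  `⟨⟨M_ext⟩⟩ ⊆ φ(U)`, and avoids the white-hole region, `φ(U) ⊆ I⁺(M_ext) = M ∖ 𝓦`
  (Chruściel–Costa §2.2), i.e. it charts the d.o.c. plus at most a collar into the black hole;
  the radius is time independent and within a constant of the Euclidean radius `‖y‖` of the
  chart (as the Kerr–Schild `r`, `|r − ‖y‖| ≤ |a|`), so that truncated slabs `{t = τ, r ≤ R}` are
  time-translates of one exhaustion and the excision tubes `{rᵢ ≤ ρᵢ(t)}`, `ρᵢ = o(t)`, of the
  flat-domain clause are honest sublinear tubes (a bounded radius would void that clause).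
* **"Radius from the AF end".** The chart coordinates `y` are not tied to the `AFEnd` chart of
  the slice `𝓑.e` (that would be Alexakis–Ionescu–Klainerman's `Φ₀` extended by the flow); the
  clauses only ever use the radius through the truncations `{r ≤ R}`, all `R`, and through the
  excision tubes, for which comparability with `‖y‖` is what matters, and a radial
  reparametrisation of any `T`-adapted chart achieves it. Holes live in the universe of `𝓢`.
* **Not required**: vacuum (`IsRicciFlat` needs `[HasLeviCivita]`; routes add it per hole),
  spacelikeness of the chart slabs, normalisation `g(T, T) → −1` (the Killing field of
  `StationaryAFBlackHole` is unnormalised; a constant rescaling of chart time is immaterial for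
  `τ → ∞` statements), and exhaustiveness of the charts (a separate predicate
  `HasExhaustiveCharts`, as on the summit side).
* **What is NOT proved here (route business).** The transfer is stated at chart level
  (`IsKerr`). Deriving it from the abstract conclusion of the uniqueness theorems,
  `StationaryAFBlackHole.IsIsometricToKerrExterior` (an isometry `Φ` of `⟨⟨M_ext⟩⟩` onto
  `{r > r₊}` with no relation to the adapted chart), is a genuine lemma: one must (i) replace `Φ`
  by a future-preserving, `T`-equivariant isometry (`Φ_* T = c ∂_{t*}`, `c > 0`; the Boyer–Lindquist
  reflection `(t, φ) ↦ (−t, −φ)` is an isometry of the open Kerr exterior which does NOT extend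
  across `𝓗⁺`, and composing with it destroys lateness of the charts), using the isometry group of
  Kerr, and (ii) re-adapt the late-time chart `Ψᵢ ∘ φᵢ⁻¹ ∘ Φ⁻¹`, which needs `Cᵏ` bounds on the
  transition map uniform in time (automatic only once the transition is time-equivariant) and a
  comparison of the two slab families. None of this is formal, so it is left to the requesting
  route as an item rather than vendored as an unproved fact.

## How a route uses it

"Settles down to stationary exteriors" is `∃ (O) (d : StationaryFinalStateDecomposition 𝓢 O 2),
d.HasExhaustiveCharts ∧ O = exteriorOf … d.charted ∧ ∀ i, <class of d.hole i>`; rigidity of the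
class gives `IsKerr` charts (after re-adaptation) and sub-extremal `(Mᵢ, aᵢ)`; then
`d.toFinalStateDecomposition M a hsub hK`, `isSubextremal_toFinalStateDecomposition`,
`charted_toFinalStateDecomposition` and `hasExhaustiveCharts_toFinalStateDecomposition` produce
verbatim the settled-down conjunct of `FinalStateConjecture` (the summit's `HasExhaustiveCharts d'`
is `d'.toOver.HasExhaustiveCharts` by `Iff.rfl`).

## References

* M. Dafermos, J. Luk, *The interior of dynamical vacuum black holes I*, arXiv:1710.01722,
  §1.2.1 (p. 8) and Conjecture 1 (key `DafermosLuk2017`).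
* P. T. Chruściel, J. L. Costa, *On uniqueness of stationary vacuum black holes*, Astérisque 321
  (2008), arXiv:0806.0016, §2.1 (asymptotically flat stationary ends), §2.2 (`M_ext`, `⟨⟨M_ext⟩⟩`,
  `𝓑`, `𝓦`), Thm. 1.3 (key `ChruscielCosta2008`).
* S. Alexakis, A. D. Ionescu, S. Klainerman, CMP 299 (2010), arXiv:0904.0982, §1.1, assumption
  **GR** (adapted coordinates `T = ∂₀`, `r = |x|` on `ℝ × E_{R₀}`) (key
  `AlexakisIonescuKlainerman2009`).
* M. Dafermos, G. Holzegel, I. Rodnianski, M. Taylor, arXiv:2104.08222, §1 (consequence-form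
  convergence in a late-time chart; key `arXiv210408222`); R. Penrose 1982, Problem 12;
  S. Klainerman, C. R. Mécanique 353 (2025), §1.1.1.
-/

noncomputable section

open TopologicalSpace Manifold Filter Topology
open scoped ContDiff Topology ENNReal

universe u

namespace Literature.Geometry.Lorentzian

/-! ### Moving a reference background by a Poincaré motion -/

namespace ModelBackground

/-- The reference background `B` **moved by the Poincaré motion `(Λ, c)`**: domain the preimage
of `B.domain` under the inverse Poincaré map `x ↦ Λ⁻¹(x − c)`, reference form the pullback
`(v, w) ↦ g₀(Λ⁻¹(x − c))(Λ⁻¹ v, Λ⁻¹ w)`, time and radius the rest-frame ones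
`t(Λ⁻¹(x − c))`, `r(Λ⁻¹(x − c))`. For `B = Kerr.background M a` this is `boostedKerrBackground`
(`Kerr.background_boost`). Final state conjecture folklore ("moving away from each other"):
Dafermos–Luk arXiv:1710.01722, §1.2.1. [cite: DafermosLuk2017, §1.2.1] -/
def boost (B : ModelBackground) (Λ : lorentzGroup) (c : E4) : ModelBackground where
  domain := ⟨poincareInv Λ c ⁻¹' (B.domain : Set E4),
    B.domain.isOpen.preimage (continuous_poincareInv Λ c)⟩
  bilin x := (ContinuousLinearMap.precomp ℝ ((Λ : E4 ≃L[ℝ] E4).symm : E4 →L[ℝ] E4)).comp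
    ((B.bilin (poincareInv Λ c x)).comp ((Λ : E4 ≃L[ℝ] E4).symm : E4 →L[ℝ] E4))
  time x := B.time (poincareInv Λ c x)
  radius x := B.radius (poincareInv Λ c x)

/-- Membership in the moved domain (Dafermos–Luk arXiv:1710.01722, §1.2.1). [cite: DafermosLuk2017, §1.2.1] -/
@[simp]
theorem mem_boost_domain {B : ModelBackground} {Λ : lorentzGroup} {c x : E4} :
    x ∈ (B.boost Λ c).domain ↔ poincareInv Λ c x ∈ B.domain :=
  Iff.rfl

/-- Unfolding lemma: `(B.boost Λ c).bilin x v w = g₀(Λ⁻¹(x − c))(Λ⁻¹ v, Λ⁻¹ w)`. [folklore] -/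
theorem boost_bilin_apply (B : ModelBackground) (Λ : lorentzGroup) (c x v w : E4) :
    (B.boost Λ c).bilin x v w =
      B.bilin (poincareInv Λ c x) ((Λ : E4 ≃L[ℝ] E4).symm v) ((Λ : E4 ≃L[ℝ] E4).symm w) :=
  rfl

/-- The time function of the moved background is the rest-frame time. [folklore] -/
@[simp]
theorem boost_time (B : ModelBackground) (Λ : lorentzGroup) (c x : E4) :
    (B.boost Λ c).time x = B.time (poincareInv Λ c x) :=
  rfl

/-- The radius of the moved background is the rest-frame radius. [folklore] -/
@[simp]
theorem boost_radius (B : ModelBackground) (Λ : lorentzGroup) (c x : E4) :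
    (B.boost Λ c).radius x = B.radius (poincareInv Λ c x) :=
  rfl

/-- The trivial motion `(1, 0)` does not move the background. [folklore] -/
@[simp]
theorem boost_one_zero (B : ModelBackground) : B.boost 1 0 = B := by
  have hP : ∀ x : E4, poincareInv 1 0 x = x := fun x ↦ by rw [poincareInv, sub_zero]; rfl
  obtain ⟨U, b, t, r⟩ := B
  simp only [boost, hP]
  congr 1
  ext x
  simp [hP]

end ModelBackground

/-- `boostedKerrBackground` is the Kerr background moved by `(Λ, c)` (definitional).
Klainerman, "Brief history", §4; Dafermos–Luk arXiv:1710.01722, §1.2.1. [cite: DafermosLuk2017, §1.2.1] -/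
theorem Kerr.background_boost (M a : ℝ) (Λ : lorentzGroup) (c : E4) :
    (Kerr.background M a).boost Λ c = boostedKerrBackground Λ c M a :=
  rfl

/-! ### The background-generic final state decomposition -/

/-- **`N`-hole final state decomposition of `𝒟 ⊆ 𝓢.carrier` in `Cᵏ`, modelled on the reference
backgrounds `B : Fin N → ModelBackground`**: the clauses of `FinalStateDecomposition`
(`KerrConvergence.lean`, whose docstring explains each of them and the reviews that shaped them)
with `boostedKerrBackground Λᵢ cᵢ Mᵢ aᵢ` replaced by `B i` — a common late time `τ₀`; late-time
charts `chart i` on `(B i).domain` and a flat chart on `flatDomain ⊆ E4`, all `IsLateChart` into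
`𝒟`; near-zone `Cᵏ` convergence to `B i` on every truncated slab `{tᵢ = τ, rᵢ ≤ R}`; separation of
the truncated world-tubes; sublinear excision radii `ρᵢ` with
`{x⁰ > τ₀} ∖ ⋃ᵢ {rᵢ ≤ ρᵢ(x⁰)} ⊆ flatDomain` (here `rᵢ = (B i).radius`, a total function on `E4`);
full `Cᵏ` convergence to `η` on the flat chart; one global covering clause. No printed `N ≥ 2`
formulation exists (Dafermos–Luk arXiv:1710.01722, §1.2.1: "either disperse or settle down to
finitely many rotating Kerr black holes moving away from each other"); `FinalStateDecomposition`
is the instance `B i = boostedKerrBackground …` (`FinalStateDecomposition.toOver/ofOver`) and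
`StationaryFinalStateDecomposition` the instance on boosted adapted charts of stationary black
holes. [cite: DafermosLuk2017, §1.2.1] -/
structure FinalStateDecompositionOver (𝓢 : Spacetime.{u} 4) (𝒟 : Set 𝓢.carrier) (k : ℕ) {N : ℕ}
    (B : Fin N → ModelBackground) where
  /-- The common initial late time `τ₀` of all charts. -/
  τ₀ : ℝ
  /-- The late-time chart of hole `i`, on the domain of its background `B i`. -/
  chart : ∀ i, (B i).domain → 𝓢.carrier
  /-- Each `chart i` is a late-time chart into `𝒟` after `τ₀`. -/
  isLateChart : ∀ i, 𝓢.IsLateChart (B i) 𝒟 τ₀ (chart i)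
  /-- Near-zone convergence: for every `R`, the `Cᵏ` deviation of `(chart i)^* g` from `B i` on
  the truncated slabs `{tᵢ = τ, rᵢ ≤ R}` tends to `0`. -/
  tendsto_truncDeviationCk : ∀ i (R : ℝ),
    Tendsto (fun τ ↦ 𝓢.truncDeviationCk (B i) (chart i) k R τ) atTop (𝓝 0)
  /-- The holes separate: for every `R` there is `τ₁` after which the truncated world-tubes
  `chart i '' {tᵢ > τ₁, rᵢ ≤ R}` are pairwise disjoint. -/
  exists_pairwise_disjoint : ∀ R : ℝ, ∃ τ₁ : ℝ,
    Pairwise (Function.onFun Disjoint fun i ↦ chart i '' (B i).truncLateRegion τ₁ R)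
  /-- The excision radius `ρᵢ(t)` of the near-zone tube of hole `i` at flat time `t`. -/
  excision : Fin N → ℝ → ℝ
  /-- The excision radii grow sublinearly, `ρᵢ(t) / t → 0`. -/
  tendsto_excision_div : ∀ i, Tendsto (fun t ↦ excision i t / t) atTop (𝓝 0)
  /-- The coordinate domain `U₀ ⊆ E4` of the flat (radiation-zone) chart. -/
  flatDomain : Opens E4
  /-- The flat domain contains the late half-space `{x⁰ > τ₀}` minus the excised tubes
  `{rᵢ(x) ≤ ρᵢ(x⁰)}`, `rᵢ = (B i).radius` (for moved backgrounds: the rest-frame radius around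
  the hole's world-line). -/
  setOf_lt_excision_subset_flatDomain :
    {x : E4 | τ₀ < x 0 ∧ ∀ i, excision i (x 0) < (B i).radius x} ⊆ flatDomain
  /-- The flat (radiation-zone) chart. -/
  flatChart : flatDomain → 𝓢.carrier
  /-- The flat chart is a late-time chart into `𝒟` after `τ₀`. -/
  isLateChart_flat : 𝓢.IsLateChart (Minkowski.backgroundOn flatDomain) 𝒟 τ₀ flatChart
  /-- Radiation zone: the full `Cᵏ` deviation of `flatChart^* g` from `η` on the flat slabs
  tends to `0`. -/
  tendsto_deviationCk_flat :
    Tendsto (fun τ ↦ 𝓢.deviationCk (Minkowski.backgroundOn flatDomain) flatChart k τ)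
      atTop (𝓝 0)
  /-- Global covering clause: the part of `𝒟` not covered by the late images of the `N + 1`
  charts lies in the causal past of the images of their initial slabs `{t = τ₀}`. -/
  diff_subset_causalPast :
    𝒟 \ ((⋃ i, chart i '' (B i).lateRegion τ₀) ∪
        flatChart '' (Minkowski.backgroundOn flatDomain).lateRegion τ₀) ⊆
      𝓢.metric.causalPast 𝓢.timeOrientation
        ((⋃ i, chart i '' (B i).timeSlab τ₀) ∪
          flatChart '' (Minkowski.backgroundOn flatDomain).timeSlab τ₀)

namespace FinalStateDecompositionOver

variable {𝓢 : Spacetime.{u} 4} {𝒟 : Set 𝓢.carrier} {k N : ℕ} {B B' : Fin N → ModelBackground}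

/-- The **black-hole region** of hole `i`: the image of the late model domain `{tᵢ > τ₀}` under
`chart i`. Klainerman, C. R. Mécanique 353 (2025), §1.1.1. [cite: Klainerman2025, §1.1.1] -/
def region (d : FinalStateDecompositionOver 𝓢 𝒟 k B) (i : Fin N) : Set 𝓢.carrier :=
  d.chart i '' (B i).lateRegion d.τ₀

/-- The **radiation zone**: the image of the late flat domain `{x⁰ > τ₀} ∩ U₀` under the flat
chart. Klainerman, C. R. Mécanique 353 (2025), §1.1.1. [cite: Klainerman2025, §1.1.1] -/
def radiationZone (d : FinalStateDecompositionOver 𝓢 𝒟 k B) : Set 𝓢.carrier :=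
  d.flatChart '' (Minkowski.backgroundOn d.flatDomain).lateRegion d.τ₀

/-- The **charted late region**: radiation zone plus the `N` black-hole regions (the shape of
`FinalStateDecomposition.charted`). Klainerman, C. R. Mécanique 353 (2025), §1.1.1. [cite: Klainerman2025, §1.1.1] -/
def charted (d : FinalStateDecompositionOver 𝓢 𝒟 k B) : Set 𝓢.carrier :=
  d.radiationZone ∪ ⋃ i, d.region i

/-- Each black-hole region lies in `𝒟`. [folklore] -/
theorem region_subset (d : FinalStateDecompositionOver 𝓢 𝒟 k B) (i : Fin N) : d.region i ⊆ 𝒟 :=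
  (d.isLateChart i).image_subset

/-- The radiation zone lies in `𝒟`. [folklore] -/
theorem radiationZone_subset (d : FinalStateDecompositionOver 𝓢 𝒟 k B) : d.radiationZone ⊆ 𝒟 :=
  d.isLateChart_flat.image_subset

/-- The charted late region lies in `𝒟`. [folklore] -/
theorem charted_subset (d : FinalStateDecompositionOver 𝓢 𝒟 k B) : d.charted ⊆ 𝒟 :=
  Set.union_subset d.radiationZone_subset (Set.iUnion_subset d.region_subset)

/-- The **certified late region after chart time `τ₁`** for near-zone radii `R`: the flat chart's
image of `{x⁰ > τ₁}` and each hole chart's image of its growing near zone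
`{tᵢ > τ₁, rᵢ ≤ Rᵢ(tᵢ)}` (the shape of `Summit.FinalStateConjecture.certifiedLate`).
Dafermos–Luk arXiv:1710.01722, Conjecture 1 (b). [cite: DafermosLuk2017, Conjecture 1 (b)] -/
def certifiedLate (d : FinalStateDecompositionOver 𝓢 𝒟 k B) (R : Fin N → ℝ → ℝ) (τ₁ : ℝ) :
    Set 𝓢.carrier :=
  d.flatChart '' (Minkowski.backgroundOn d.flatDomain).lateRegion τ₁ ∪
    ⋃ i, d.chart i '' {x | τ₁ < (B i).time x.1 ∧ (B i).radius x.1 ≤ R i ((B i).time x.1)}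

/-- The **certified slab at chart time `τ₁`**: the flat chart's image of `{x⁰ = τ₁} ∩ U₀` and
each hole chart's image of the truncated slab `{tᵢ = τ₁, rᵢ ≤ Rᵢ(τ₁)}` (the shape of
`Summit.FinalStateConjecture.certifiedSlab`). Dafermos–Luk arXiv:1710.01722, Conjecture 1 (b). [cite: DafermosLuk2017, Conjecture 1 (b)] -/
def certifiedSlab (d : FinalStateDecompositionOver 𝓢 𝒟 k B) (R : Fin N → ℝ → ℝ) (τ₁ : ℝ) :
    Set 𝓢.carrier :=
  d.flatChart '' (Minkowski.backgroundOn d.flatDomain).timeSlab τ₁ ∪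
    ⋃ i, d.chart i '' (B i).truncTimeSlab (R i τ₁) τ₁

/-- **The charts exhaust `𝒟`** (the shape of `Summit.FinalStateConjecture.HasExhaustiveCharts`,
human ruling F2 of the summit audit): there are near-zone radii `Rᵢ : ℝ → ℝ` such that (i) the
`Cᵏ` deviation from `B i` still tends to `0` on the growing truncated slabs `{tᵢ = τ, rᵢ ≤ Rᵢ(τ)}`
and (ii) for EVERY chart time `τ₁ > τ₀`, every point of `𝒟` outside the certified late region
after `τ₁` lies in the causal past of the certified slab at `τ₁`. Dafermos–Luk arXiv:1710.01722,
Conjecture 1 (b)–(c); DHRT arXiv:2104.08222, §1. [cite: DafermosLuk2017, Conjecture 1 (b)–(c)] -/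
def HasExhaustiveCharts (d : FinalStateDecompositionOver 𝓢 𝒟 k B) : Prop :=
  ∃ R : Fin N → ℝ → ℝ,
    (∀ i, Tendsto (fun τ ↦ 𝓢.truncDeviationCk (B i) (d.chart i) k (R i τ) τ) atTop (𝓝 0)) ∧
    ∀ τ₁ : ℝ, d.τ₀ < τ₁ →
      𝒟 \ d.certifiedLate R τ₁ ⊆ 𝓢.metric.causalPast 𝓢.timeOrientation (d.certifiedSlab R τ₁)

/-- Transport of a decomposition along an equality of background families (used by the
Kerr transfer `StationaryFinalStateDecomposition.toFinalStateDecomposition`). [folklore] -/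
def copy (d : FinalStateDecompositionOver 𝓢 𝒟 k B) (e : B = B') :
    FinalStateDecompositionOver 𝓢 𝒟 k B' :=
  e ▸ d

/-- Transport along `rfl` is the identity. [folklore] -/
@[simp]
theorem copy_rfl (d : FinalStateDecompositionOver 𝓢 𝒟 k B) : d.copy rfl = d := rfl

/-- Transport does not change the late time. [folklore] -/
@[simp]
theorem τ₀_copy (d : FinalStateDecompositionOver 𝓢 𝒟 k B) (e : B = B') : (d.copy e).τ₀ = d.τ₀ := by
  subst e; rfl

/-- Transport does not change the charted late region. [folklore] -/
@[simp]
theorem charted_copy (d : FinalStateDecompositionOver 𝓢 𝒟 k B) (e : B = B') :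
    (d.copy e).charted = d.charted := by
  subst e; rfl

/-- Transport does not change the black-hole regions. [folklore] -/
@[simp]
theorem region_copy (d : FinalStateDecompositionOver 𝓢 𝒟 k B) (e : B = B') (i : Fin N) :
    (d.copy e).region i = d.region i := by
  subst e; rfl

/-- Transport preserves exhaustiveness of the charts. [folklore] -/
theorem HasExhaustiveCharts.copy {d : FinalStateDecompositionOver 𝓢 𝒟 k B}
    (h : d.HasExhaustiveCharts) (e : B = B') : (d.copy e).HasExhaustiveCharts := by
  subst e; exact h

end FinalStateDecompositionOver

/-! ### Specialisation: Kerr backgrounds give back `FinalStateDecomposition` -/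

namespace FinalStateDecomposition

variable {𝓢 : Spacetime.{u} 4} {𝒟 : Set 𝓢.carrier} {k : ℕ}

/-- The background-generic part of a final state decomposition (backgrounds
`d.background i = boostedKerrBackground Λᵢ cᵢ Mᵢ aᵢ`): field for field. Dafermos–Luk
arXiv:1710.01722, §1.2.1. [cite: DafermosLuk2017, §1.2.1] -/
def toOver (d : FinalStateDecomposition 𝓢 𝒟 k) : FinalStateDecompositionOver 𝓢 𝒟 k d.background where
  τ₀ := d.τ₀
  chart := d.chart
  isLateChart := d.isLateChart
  tendsto_truncDeviationCk := d.tendsto_truncDeviationCk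
  exists_pairwise_disjoint := d.exists_pairwise_disjoint
  excision := d.excision
  tendsto_excision_div := d.tendsto_excision_div
  flatDomain := d.flatDomain
  setOf_lt_excision_subset_flatDomain := d.setOf_lt_excision_subset_flatDomain
  flatChart := d.flatChart
  isLateChart_flat := d.isLateChart_flat
  tendsto_deviationCk_flat := d.tendsto_deviationCk_flat
  diff_subset_causalPast := d.diff_subset_causalPast

/-- Conversely, a generic decomposition on boosted Kerr backgrounds with `0 < Mᵢ`, `|aᵢ| ≤ Mᵢ` is a
final state decomposition. Dafermos–Luk arXiv:1710.01722, §1.2.1. [cite: DafermosLuk2017, §1.2.1] -/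
def ofOver {N : ℕ} (mass spin : Fin N → ℝ) (mass_pos : ∀ i, 0 < mass i)
    (abs_spin_le_mass : ∀ i, |spin i| ≤ mass i) (motion : Fin N → lorentzGroup × E4)
    (d : FinalStateDecompositionOver 𝓢 𝒟 k
      fun i ↦ boostedKerrBackground (motion i).1 (motion i).2 (mass i) (spin i)) :
    FinalStateDecomposition 𝓢 𝒟 k where
  N := N
  mass := mass
  spin := spin
  mass_pos := mass_pos
  abs_spin_le_mass := abs_spin_le_mass
  motion := motion
  τ₀ := d.τ₀
  chart := d.chart
  isLateChart := d.isLateChart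
  tendsto_truncDeviationCk := d.tendsto_truncDeviationCk
  exists_pairwise_disjoint := d.exists_pairwise_disjoint
  excision := d.excision
  tendsto_excision_div := d.tendsto_excision_div
  flatDomain := d.flatDomain
  setOf_lt_excision_subset_flatDomain := d.setOf_lt_excision_subset_flatDomain
  flatChart := d.flatChart
  isLateChart_flat := d.isLateChart_flat
  tendsto_deviationCk_flat := d.tendsto_deviationCk_flat
  diff_subset_causalPast := d.diff_subset_causalPast

/-- Round trip (generic → Kerr → generic) is the identity. [folklore] -/
@[simp]
theorem toOver_ofOver {N : ℕ} (mass spin : Fin N → ℝ) (mass_pos : ∀ i, 0 < mass i)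
    (abs_spin_le_mass : ∀ i, |spin i| ≤ mass i) (motion : Fin N → lorentzGroup × E4)
    (d : FinalStateDecompositionOver 𝓢 𝒟 k
      fun i ↦ boostedKerrBackground (motion i).1 (motion i).2 (mass i) (spin i)) :
    (ofOver mass spin mass_pos abs_spin_le_mass motion d).toOver = d :=
  rfl

/-- Round trip (Kerr → generic → Kerr) is the identity. [folklore] -/
@[simp]
theorem ofOver_toOver (d : FinalStateDecomposition 𝓢 𝒟 k) :
    ofOver d.mass d.spin d.mass_pos d.abs_spin_le_mass d.motion d.toOver = d := by
  cases d; rfl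

/-- The generic charted late region of `d.toOver` is `d.charted` (`FinalState.lean`). [folklore] -/
@[simp]
theorem charted_toOver (d : FinalStateDecomposition 𝓢 𝒟 k) : d.toOver.charted = d.charted := rfl

/-- The generic black-hole regions of `d.toOver` are those of `d`. [folklore] -/
@[simp]
theorem region_toOver (d : FinalStateDecomposition 𝓢 𝒟 k) (i : Fin d.N) :
    d.toOver.region i = d.region i := rfl

/-- The generic radiation zone of `d.toOver` is that of `d`. [folklore] -/
@[simp]
theorem radiationZone_toOver (d : FinalStateDecomposition 𝓢 𝒟 k) :
    d.toOver.radiationZone = d.radiationZone := rfl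

end FinalStateDecomposition

/-! ### `T`-adapted charts of a stationary black hole -/

namespace StationaryAFBlackHole

/-- A **`T`-adapted late-time chart** of the stationary asymptotically flat black hole `𝓑`
(Alexakis–Ionescu–Klainerman, arXiv:0904.0982, §1.1, assumption **GR**: coordinates `{x⁰, xⁱ}` on
`ℝ × E_{R₀}` with `T = ∂₀` and `r = |x|`; Chruściel–Costa, arXiv:0806.0016, §2.2 for `M_ext`,
`⟨⟨M_ext⟩⟩` and the white-hole region `𝓦 = M ∖ I⁺(M_ext)`): an open coordinate domain `U ⊆ E4`
and a smooth open embedding `φ : U → M` such that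

* `U` is invariant under time translations `(t, y) ↦ (t', y)` and `dφ(∂₀) = T` (chart time
  `x⁰` is the Killing parameter: `φ` intertwines time translation with the flow of `T`);
* `φ(U)` contains the domain of outer communications `⟨⟨M_ext⟩⟩` and is contained in
  `I⁺(M_ext) = M ∖ 𝓦` (it charts the d.o.c. and at most a collar into the black-hole region
  across the future event horizon, never a white hole);
* the chart comes with the components `bilin` of the model metric, a TOTAL function on `E4`
  which ON `U` equals the pullback `φ^* g` (values off `U` are junk, as for
  `ModelBackground.bilin`), and with a `radius` function which is time independent and within a
  constant of the Euclidean radius `‖y‖` of the chart (as the Kerr–Schild `r`, `|r − ‖y‖| ≤ |a|`).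

The ingoing Kerr–Schild exterior chart of Kerr, with `bilin = Kerr.bilin M a`,
`radius = Kerr.radius a`, is the model instance (`AdaptedChart.IsKerr`). This is a *hypothesis
structure* (data + the properties the statements consume). [cite: AlexakisIonescuKlainerman2009, §1.1 assumption GR] -/
structure AdaptedChart (𝓑 : StationaryAFBlackHole.{u}) where
  /-- The coordinate domain `U ⊆ E4`. -/
  domain : Opens E4
  /-- The chart map `φ : U → M`. -/
  toFun : domain → 𝓑.carrier
  /-- The model metric components in the chart, as a total function on `E4` (junk off `U`). -/
  bilin : E4 → E4 →L[ℝ] E4 →L[ℝ] ℝ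
  /-- The radius function of the chart (junk off `U`). -/
  radius : E4 → ℝ
  /-- `φ` is smooth. -/
  contMDiff : ContMDiff 𝓘(ℝ, E4) (𝓡 4) ∞ toFun
  /-- `φ` is an open topological embedding. -/
  isOpenEmbedding : IsOpenEmbedding toFun
  /-- On `U` the model form is the pullback of the spacetime metric, `bilin = φ^* g`. -/
  bilin_eq : ∀ x : domain, bilin x.1 =
    (show E4 →L[ℝ] E4 →L[ℝ] ℝ from pullbackBilin (I := 𝓡 4) (I' := 𝓘(ℝ, E4)) toFun 𝓑.metric.val x)
  /-- `U` is invariant under time translations. -/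
  mem_domain_ofTimeSpace : ∀ (t t' : ℝ) (y : E3),
    E4.ofTimeSpace t y ∈ domain → E4.ofTimeSpace t' y ∈ domain
  /-- `T`-adapted: `dφ(∂₀)` is the stationary Killing field. -/
  mfderiv_toFun_basisVector : ∀ x : domain,
    mfderiv 𝓘(ℝ, E4) (𝓡 4) toFun x (E4.basisVector 0) = 𝓑.killing (toFun x)
  /-- The chart covers the domain of outer communications `⟨⟨M_ext⟩⟩`. -/
  doc_subset_range : 𝓑.doc ⊆ Set.range toFun
  /-- The chart avoids the white-hole region: `φ(U) ⊆ I⁺(M_ext)`. -/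
  range_subset_chronologicalFuture :
    Set.range toFun ⊆ 𝓑.metric.chronologicalFuture 𝓑.timeOrientation 𝓑.Mext
  /-- The radius is time independent. -/
  radius_ofTimeSpace : ∀ (t : ℝ) (y : E3), radius (E4.ofTimeSpace t y) = radius (E4.ofTimeSpace 0 y)
  /-- The radius is within a constant of the Euclidean radius of the chart. -/
  exists_abs_radius_sub_spatialNorm_le : ∃ C : ℝ, ∀ x : E4, |radius x - E4.spatialNorm x| ≤ C

namespace AdaptedChart

variable {𝓑 : StationaryAFBlackHole.{u}} (A : 𝓑.AdaptedChart)

/-- The **reference background of an adapted chart**: `(U, φ^* g, t = x⁰, r)` — the stationary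
black hole read in its `T`-adapted chart, in the format of `KerrConvergence.lean`.
Alexakis–Ionescu–Klainerman arXiv:0904.0982, §1.1 (GR); DHRT arXiv:2104.08222, §1. [cite: AlexakisIonescuKlainerman2009, §1.1] -/
def background : ModelBackground where
  domain := A.domain
  bilin := A.bilin
  time x := x 0
  radius := A.radius

/-- The domain of the adapted background is the chart domain. [folklore] -/
@[simp] theorem background_domain : A.background.domain = A.domain := rfl

/-- The reference form of the adapted background is `A.bilin`. [folklore] -/
@[simp] theorem background_bilin : A.background.bilin = A.bilin := rfl

/-- The time function of the adapted background is `x⁰`. [folklore] -/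
@[simp] theorem background_time (x : E4) : A.background.time x = x 0 := rfl

/-- The radius of the adapted background is `A.radius`. [folklore] -/
@[simp] theorem background_radius : A.background.radius = A.radius := rfl

/-- On the chart domain the deviation from the adapted background is the difference of
pullbacks `Ψ^* g_𝓢 − φ^* g_𝓑` (DHRT arXiv:2104.08222, §1). [cite: arXiv210408222, §1] -/
theorem deviation_background (𝓢 : Spacetime.{u} 4) (Ψ : A.domain → 𝓢.carrier) (x : A.domain) :
    𝓢.deviation A.background Ψ x =
      (show E4 →L[ℝ] E4 →L[ℝ] ℝ from
          pullbackBilin (I := 𝓡 4) (I' := 𝓘(ℝ, E4)) Ψ 𝓢.metric.val x) -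
        (show E4 →L[ℝ] E4 →L[ℝ] ℝ from
          pullbackBilin (I := 𝓡 4) (I' := 𝓘(ℝ, E4)) A.toFun 𝓑.metric.val x) := by
  rw [Spacetime.deviation, ← A.bilin_eq x]
  rfl

/-- The chart images of the truncated slabs are time-translates of one another's model sets:
`(t, y) ∈ {t = τ, r ≤ R}` iff `(0, y) ∈ U`, `r(0, y) ≤ R` (time invariance of domain and
radius). [folklore] -/
theorem ofTimeSpace_mem_truncTimeSlab_iff (τ R : ℝ) (y : E3) (h : E4.ofTimeSpace τ y ∈ A.domain) :
    (⟨E4.ofTimeSpace τ y, h⟩ : A.domain) ∈ A.background.truncTimeSlab R τ ↔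
      A.radius (E4.ofTimeSpace 0 y) ≤ R := by
  show E4.ofTimeSpace τ y 0 = τ ∧ A.radius (E4.ofTimeSpace τ y) ≤ R ↔ _
  rw [A.radius_ofTimeSpace τ y]
  simp

/-- **The adapted chart is the ingoing Kerr–Schild exterior chart of Kerr `(M, a)`**: its domain
is `Kerr.exterior M a = {r > r₊}`, its model form is the Kerr–Schild form `Kerr.bilin M a` and its
radius the Kerr–Schild radius (so `A.background = Kerr.background M a`, `IsKerr.background_eq`).
This is the chart-level form of "the domain of outer communications of `𝓑` is isometric to the
Kerr exterior" under which the transfer to `FinalStateDecomposition` is formal; see the module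
docstring for its relation to `StationaryAFBlackHole.IsIsometricToKerrExterior`.
Chruściel–Costa arXiv:0806.0016, Thm. 1.3 (conclusion); Dafermos–Rodnianski arXiv:0811.0354, §5.1
(the chart). [cite: ChruscielCosta2008, Thm. 1.3] -/
structure IsKerr (M a : ℝ) : Prop where
  /-- The chart domain is the Kerr exterior `{r > r₊}`. -/
  domain_eq : A.domain = Kerr.exterior M a
  /-- The model form is the Kerr–Schild form. -/
  bilin_eq_kerr : A.bilin = Kerr.bilin M a
  /-- The radius is the Kerr–Schild radius. -/
  radius_eq : A.radius = Kerr.radius a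

variable {A} in
/-- A Kerr-adapted chart has the Kerr reference background. [cite: ChruscielCosta2008, Thm. 1.3] -/
theorem IsKerr.background_eq {M a : ℝ} (h : A.IsKerr M a) : A.background = Kerr.background M a := by
  obtain ⟨h₁, h₂, h₃⟩ := h
  cases A
  dsimp only at h₁ h₂ h₃
  subst h₁ h₂ h₃
  rfl

end AdaptedChart

end StationaryAFBlackHole

/-! ### The stationary final state decomposition -/

/-- **Hypothesis structure: `N`-black-hole final state decomposition of `𝒟 ⊆ 𝓢.carrier` in `Cᵏ`,
modelled on general stationary exteriors.** The data of `FinalStateDecomposition` with the boosted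
sub-extremal Kerr backgrounds replaced by arbitrary stationary asymptotically flat black holes:
`N` holes `𝓑ᵢ : StationaryAFBlackHole`, a `T`-adapted chart `φᵢ` of each (`AdaptedChart`: time =
Killing parameter, covering `⟨⟨M_ext⟩⟩ᵢ` plus at most a horizon collar), asymptotic motions
`(Λᵢ, cᵢ)`, and a `FinalStateDecompositionOver` on the moved adapted backgrounds
`(φᵢ^* g_{𝓑ᵢ}) ∘ (Λᵢ, cᵢ)⁻¹` — common late time, late-time charts, `Cᵏ` convergence to `φᵢ^* g_{𝓑ᵢ}`
on every truncated slab, separating near zones, sublinear excision tubes, a flat chart converging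
to `η`, one covering clause. Exhaustiveness of the charts is the separate predicate
`HasExhaustiveCharts`; vacuum of the `𝓑ᵢ` is not part of the structure. Dafermos–Luk
arXiv:1710.01722, §1.2.1 (p. 8: if analyticity can be removed from black-hole uniqueness, "vacuum
spacetimes arising from generic asymptotically flat Cauchy data … will either disperse or settle
down to finitely many rotating Kerr black holes moving away from each other"): this structure is
the intermediate "settles down to finitely many stationary black holes" of that sentence. No
printed formulation exists. [cite: DafermosLuk2017, §1.2.1] -/
structure StationaryFinalStateDecomposition (𝓢 : Spacetime.{u} 4) (𝒟 : Set 𝓢.carrier) (k : ℕ) where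
  /-- The number of final black holes. -/
  N : ℕ
  /-- The stationary model black holes `𝓑ᵢ`. -/
  hole : Fin N → StationaryAFBlackHole.{u}
  /-- The `T`-adapted chart of `𝓑ᵢ`. -/
  adapted : ∀ i, (hole i).AdaptedChart
  /-- The asymptotic motion `(Λᵢ, cᵢ)` of black hole `i`. -/
  motion : Fin N → lorentzGroup × E4
  /-- The decomposition proper (the background-generic clauses of `FinalStateDecomposition`), on
  the moved adapted backgrounds. -/
  toOver : FinalStateDecompositionOver 𝓢 𝒟 k
    fun i ↦ (adapted i).background.boost (motion i).1 (motion i).2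

namespace StationaryFinalStateDecomposition

variable {𝓢 : Spacetime.{u} 4} {𝒟 : Set 𝓢.carrier} {k : ℕ}

/-- The reference background of hole `i`: the adapted background of `𝓑ᵢ` moved by `(Λᵢ, cᵢ)`.
Dafermos–Luk arXiv:1710.01722, §1.2.1. [cite: DafermosLuk2017, §1.2.1] -/
def background (d : StationaryFinalStateDecomposition 𝓢 𝒟 k) (i : Fin d.N) : ModelBackground :=
  (d.adapted i).background.boost (d.motion i).1 (d.motion i).2

/-- The charted late region (radiation zone plus black-hole regions). Klainerman, C. R. Mécanique
353 (2025), §1.1.1. [cite: Klainerman2025, §1.1.1] -/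
abbrev charted (d : StationaryFinalStateDecomposition 𝓢 𝒟 k) : Set 𝓢.carrier :=
  d.toOver.charted

/-- The charts of `d` exhaust `𝒟` (`FinalStateDecompositionOver.HasExhaustiveCharts`).
Dafermos–Luk arXiv:1710.01722, Conjecture 1 (b)–(c). [cite: DafermosLuk2017, Conjecture 1 (b)–(c)] -/
abbrev HasExhaustiveCharts (d : StationaryFinalStateDecomposition 𝓢 𝒟 k) : Prop :=
  d.toOver.HasExhaustiveCharts

/-- The charted late region lies in `𝒟`. [folklore] -/
theorem charted_subset (d : StationaryFinalStateDecomposition 𝓢 𝒟 k) : d.charted ⊆ 𝒟 :=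
  d.toOver.charted_subset

/-- Sanity (`N = 0`): convergence to Minkowski space in `𝒟` is a stationary decomposition with no
black hole (Christodoulou–Klainerman 1993, Thm. 1.0.2). [cite: ChristodoulouKlainerman1993, Thm. 1.0.2] -/
def ofConvergesToMinkowski (h : 𝓢.ConvergesToMinkowski 𝒟 k) :
    StationaryFinalStateDecomposition 𝓢 𝒟 k where
  N := 0
  hole := Fin.elim0
  adapted i := i.elim0
  motion := Fin.elim0
  toOver := (FinalStateDecomposition.ofConvergesToMinkowski h).toOver.copy (funext fun i ↦ i.elim0)

/-- If every adapted chart is a Kerr–Schild exterior chart, the moved adapted backgrounds are the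
boosted Kerr backgrounds. [cite: ChruscielCosta2008, Thm. 1.3] -/
theorem background_eq_of_isKerr (d : StationaryFinalStateDecomposition 𝓢 𝒟 k) {M a : Fin d.N → ℝ}
    (hK : ∀ i, (d.adapted i).IsKerr (M i) (a i)) :
    (fun i ↦ (d.adapted i).background.boost (d.motion i).1 (d.motion i).2) =
      fun i ↦ boostedKerrBackground (d.motion i).1 (d.motion i).2 (M i) (a i) :=
  funext fun i ↦ by rw [(hK i).background_eq]; rfl

/-- **Transfer (chart level).** A stationary final state decomposition all of whose adapted charts
are ingoing Kerr–Schild exterior charts of sub-extremal Kerr black holes `(Mᵢ, aᵢ)` (`IsKerr`: the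
chart-level strengthening of the conclusion "`⟨⟨M_ext⟩⟩` is isometric to a Kerr exterior" of
black-hole uniqueness, Chruściel–Costa arXiv:0806.0016, Thm. 1.3; see the module docstring for the
gap between the two) IS a final state decomposition in the sense of `KerrConvergence.lean`, with
the same `N`, motions, charts and late time, and parameters `(Mᵢ, aᵢ)` (`0 < Mᵢ`, `|aᵢ| ≤ Mᵢ` from
`|aᵢ| < Mᵢ`). Dafermos–Luk arXiv:1710.01722, §1.2.1. [cite: DafermosLuk2017, §1.2.1] -/
def toFinalStateDecomposition (d : StationaryFinalStateDecomposition 𝓢 𝒟 k) (M a : Fin d.N → ℝ)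
    (hsub : ∀ i, Kerr.IsSubextremal (M i) (a i)) (hK : ∀ i, (d.adapted i).IsKerr (M i) (a i)) :
    FinalStateDecomposition 𝓢 𝒟 k :=
  FinalStateDecomposition.ofOver M a (fun i ↦ (hsub i).pos) (fun i ↦ (hsub i).le) d.motion
    (d.toOver.copy (d.background_eq_of_isKerr hK))

section Transfer

variable (d : StationaryFinalStateDecomposition 𝓢 𝒟 k) (M a : Fin d.N → ℝ)
  (hsub : ∀ i, Kerr.IsSubextremal (M i) (a i)) (hK : ∀ i, (d.adapted i).IsKerr (M i) (a i))

/-- The transfer keeps the number of holes. [folklore] -/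
@[simp] theorem toFinalStateDecomposition_N : (d.toFinalStateDecomposition M a hsub hK).N = d.N := rfl

/-- The masses of the transfer are the `Mᵢ`. [folklore] -/
@[simp] theorem toFinalStateDecomposition_mass : (d.toFinalStateDecomposition M a hsub hK).mass = M :=
  rfl

/-- The spins of the transfer are the `aᵢ`. [folklore] -/
@[simp] theorem toFinalStateDecomposition_spin : (d.toFinalStateDecomposition M a hsub hK).spin = a :=
  rfl

/-- The motions of the transfer are those of `d`. [folklore] -/
@[simp] theorem toFinalStateDecomposition_motion :
    (d.toFinalStateDecomposition M a hsub hK).motion = d.motion := rfl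

/-- The late time of the transfer is that of `d`. [folklore] -/
@[simp] theorem toFinalStateDecomposition_τ₀ :
    (d.toFinalStateDecomposition M a hsub hK).τ₀ = d.toOver.τ₀ :=
  d.toOver.τ₀_copy _

/-- Every hole of the transfer is sub-extremal, `|aᵢ| < Mᵢ` (the summit's conjunct
`∀ i, Kerr.IsSubextremal (d.mass i) (d.spin i)`). [folklore] -/
theorem isSubextremal_toFinalStateDecomposition (i : Fin d.N) :
    Kerr.IsSubextremal ((d.toFinalStateDecomposition M a hsub hK).mass i)
      ((d.toFinalStateDecomposition M a hsub hK).spin i) :=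
  hsub i

/-- The transfer keeps the charted late region (so the self-determined exterior
`J⁺(ι X) ∩ I⁻(charted)` of the summit statement is unchanged). [folklore] -/
@[simp] theorem charted_toFinalStateDecomposition :
    (d.toFinalStateDecomposition M a hsub hK).charted = d.charted :=
  d.toOver.charted_copy _

/-- The transfer keeps exhaustiveness of the charts (read through `FinalStateDecomposition.toOver`;
on the summit side `Summit.FinalStateConjecture.HasExhaustiveCharts d' ↔ d'.toOver.HasExhaustiveCharts`
holds by `Iff.rfl`). [folklore] -/
theorem hasExhaustiveCharts_toFinalStateDecomposition (h : d.HasExhaustiveCharts) :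
    (d.toFinalStateDecomposition M a hsub hK).toOver.HasExhaustiveCharts :=
  h.copy _

end Transfer

end StationaryFinalStateDecomposition

end Literature.Geometry.Lorentzian

end
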